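import Summits.AnomalousDissipation.AnomalousDissipation.Theorems.MomentParityQuarticGateCubicAlgebra
import Summits.AnomalousDissipation.AnomalousDissipation.Theorems.MomentParityQuarticGateCubicComplexifySingle

/-!
# Cubic assembly for the axial Casimir stub (line `axis-sectors` of crux `MomentParity.QuarticGate`), I:
# the quartet identity

For test families `vⱼ` (`vⱼ 0 = 0`) and a real homogeneous cubic `P` put `Pℂ = map (algebraMap ℝ ℂ) P`,
`H i j l = coeff 0 (∂ᵢ∂ⱼ∂ₗ Pℂ)`, and the sector tensors
`Γ_θ k p q a b c = [k, p, q ∈ S*, k + p + q = θ] · (1/6) Σᵢⱼₗ H i j l · vᵢ(-k)_a vⱼ(-p)_b vₗ(-q)_c`,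
`S* = (freqBall N).erase 0`. If the complexified Casimir expression (`…CubicComplexifyMain`) vanishes on
all complex families transversal on / supported in `S*`, then every `Γ_θ` satisfies the QUARTET
IDENTITY of the cubic cores (`quartet_identity`). Route: the expression is the quartic
`½ Σ H ℓⱼ(c)ℓₗ(c)Bᵢ(c,c)` (`casimirC_eq_half_sum`); polarise it on the subspace (`quartet_of_diag`:
the bundled `4`-linear map on the submodule, `sum_perm_multilinear_eq_zero_of_forall_diag` and
`sum_perm_fin_four` of `…CubicAlgebra`, twelve terms); evaluate at four transversal single modes with
the pair transfer of `…CubicComplexifySingle` (`pair_eval`), and rewrite the cores' pair double sum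
(`sum_pairs_fin_four`) and the sector indicators (`target_pair`, `indicator_erase_mul_eq`).
-/

namespace Summit.AnomalousDissipation.AnomalousDissipation.Theorems.MomentParityQuarticGate

open MeasureTheory Filter
open scoped InnerProductSpace RealInnerProductSpace ComplexConjugate ENNReal
open Literature.Analysis.FunctionSpaces Literature.Analysis.FluidPDE
open Summit.AnomalousDissipation.AnomalousDissipation.Theses.MomentParity
open Summit.AnomalousDissipation.AnomalousDissipation.Theorems.QuarticGate.Negative

-- `Summit.<Summit>.<Problem>` is the tree's mandated summit-side namespace (CONVENTIONS §2); for this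
-- single-conjunct summit the two coincide, so the duplicate is deliberate.
set_option linter.dupNamespace false

noncomputable section

section Polar

/-- **The pair double sum over `Fin 4`, explicitly**: summing `f p q` over pairs `p = (p₁ < p₂)` and
complementary pairs `q = (q₁ < q₂)` gives the six terms
`f(0,1)(2,3) + f(0,2)(1,3) + f(0,3)(1,2) + f(1,2)(0,3) + f(1,3)(0,2) + f(2,3)(0,1)`. [folklore] -/
theorem sum_pairs_fin_four {M : Type*} [AddCommMonoid M] (f : Fin 4 × Fin 4 → Fin 4 × Fin 4 → M) :
    ∑ p ∈ (Finset.univ : Finset (Fin 4 × Fin 4)).filter (fun p => p.1 < p.2),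
      ∑ q ∈ (Finset.univ : Finset (Fin 4 × Fin 4)).filter
        (fun q => q.1 < q.2 ∧ q.1 ≠ p.1 ∧ q.1 ≠ p.2 ∧ q.2 ≠ p.1 ∧ q.2 ≠ p.2), f p q =
      f (0, 1) (2, 3) + f (0, 2) (1, 3) + f (0, 3) (1, 2) + f (1, 2) (0, 3) + f (1, 3) (0, 2) + f (2, 3) (0, 1) := by
  simp only [Finset.sum_filter, Fintype.sum_prod_type, Fin.sum_univ_four, Fin.isValue]
  simp (config := { decide := true }) only [if_true, if_false, add_zero, zero_add]
  abel

/-- **Polarisation of the Casimir quartic.** On a complex vector space `F` let `ℓⱼ` be linear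
functionals, `Bᵢ` bilinear forms, `H i j l` a tensor symmetric in `(j, l)`, and `Mem` a linear
subspace (as a predicate). If `Σᵢⱼₗ H i j l · ℓⱼ(c) ℓₗ(c) Bᵢ(c, c) = 0` for all `c ∈ Mem` then for all
`c₀, c₁, c₂, c₃ ∈ Mem` the twelve-term pair polarisation
`Σ_{ {α<β} ⊔ {γ,δ} } T(c_α, c_β, c_γ, c_δ)`, `T(a,b,x,y) = Σ H i j l · ℓⱼ(a) ℓₗ(b) Bᵢ(x, y)`, vanishes. [folklore] -/
theorem quartet_of_diag {F : Type} [AddCommGroup F] [Module ℂ F] {m : ℕ}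
    (ℓf : Fin m → F → ℂ) (Bf : Fin m → F → F → ℂ) (H : Fin m → Fin m → Fin m → ℂ) (Mem : F → Prop)
    (hℓadd : ∀ j a b, ℓf j (a + b) = ℓf j a + ℓf j b) (hℓsmul : ∀ j (z : ℂ) a, ℓf j (z • a) = z * ℓf j a)
    (hBadd₁ : ∀ i a b y, Bf i (a + b) y = Bf i a y + Bf i b y)
    (hBsmul₁ : ∀ i (z : ℂ) a y, Bf i (z • a) y = z * Bf i a y)
    (hBadd₂ : ∀ i x a b, Bf i x (a + b) = Bf i x a + Bf i x b)
    (hBsmul₂ : ∀ i (z : ℂ) x a, Bf i x (z • a) = z * Bf i x a)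
    (hH : ∀ i j l, H i j l = H i l j)
    (hMadd : ∀ a b, Mem a → Mem b → Mem (a + b)) (hM0 : Mem 0) (hMsmul : ∀ (z : ℂ) a, Mem a → Mem (z • a))
    (hdiag : ∀ c, Mem c → ∑ i, ∑ j, ∑ l, H i j l * ℓf j c * ℓf l c * Bf i c c = 0)
    (c : Fin 4 → F) (hc : ∀ α, Mem (c α)) :
    let T := fun a b x y => ∑ i, ∑ j, ∑ l, H i j l * ℓf j a * ℓf l b * Bf i x y
    (T (c 2) (c 3) (c 0) (c 1) + T (c 2) (c 3) (c 1) (c 0)) + (T (c 1) (c 3) (c 0) (c 2) + T (c 1) (c 3) (c 2) (c 0)) +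
      (T (c 1) (c 2) (c 0) (c 3) + T (c 1) (c 2) (c 3) (c 0)) + (T (c 0) (c 3) (c 1) (c 2) + T (c 0) (c 3) (c 2) (c 1)) +
      (T (c 0) (c 2) (c 1) (c 3) + T (c 0) (c 2) (c 3) (c 1)) + (T (c 0) (c 1) (c 2) (c 3) + T (c 0) (c 1) (c 3) (c 2)) = 0 := by
  intro T
  -- slot-wise additivity / homogeneity of `T`
  have hT : ∀ a b x y, T a b x y = ∑ i, ∑ j, ∑ l, H i j l * ℓf j a * ℓf l b * Bf i x y := fun _ _ _ _ => rfl
  have hadd0 : ∀ a b x y w, T (a + b) x y w = T a x y w + T b x y w := by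
    intro a b x y w; simp only [hT, hℓadd, add_mul, mul_add, Finset.sum_add_distrib]
  have hsmul0 : ∀ (t : ℂ) a x y w, T (t • a) x y w = t * T a x y w := by
    intro t a x y w; simp only [hT, hℓsmul, Finset.mul_sum]
    exact Finset.sum_congr rfl fun i _ => Finset.sum_congr rfl fun j _ => Finset.sum_congr rfl fun l _ => by ring
  have hadd1 : ∀ x a b y w, T x (a + b) y w = T x a y w + T x b y w := by
    intro x a b y w; simp only [hT, hℓadd, add_mul, mul_add, Finset.sum_add_distrib]
  have hsmul1 : ∀ (t : ℂ) x a y w, T x (t • a) y w = t * T x a y w := by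
    intro t x a y w; simp only [hT, hℓsmul, Finset.mul_sum]
    exact Finset.sum_congr rfl fun i _ => Finset.sum_congr rfl fun j _ => Finset.sum_congr rfl fun l _ => by ring
  have hadd2 : ∀ x y a b w, T x y (a + b) w = T x y a w + T x y b w := by
    intro x y a b w; simp only [hT, hBadd₁, mul_add, Finset.sum_add_distrib]
  have hsmul2 : ∀ (t : ℂ) x y a w, T x y (t • a) w = t * T x y a w := by
    intro t x y a w; simp only [hT, hBsmul₁, Finset.mul_sum]
    exact Finset.sum_congr rfl fun i _ => Finset.sum_congr rfl fun j _ => Finset.sum_congr rfl fun l _ => by ring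
  have hadd3 : ∀ x y w a b, T x y w (a + b) = T x y w a + T x y w b := by
    intro x y w a b; simp only [hT, hBadd₂, mul_add, Finset.sum_add_distrib]
  have hsmul3 : ∀ (t : ℂ) x y w a, T x y w (t • a) = t * T x y w a := by
    intro t x y w a; simp only [hT, hBsmul₂, Finset.mul_sum]
    exact Finset.sum_congr rfl fun i _ => Finset.sum_congr rfl fun j _ => Finset.sum_congr rfl fun l _ => by ring
  -- symmetry in the first two slots (`H` symmetric in `(j, l)`)
  have hswap : ∀ a b x y, T b a x y = T a b x y := by
    intro a b x y
    simp only [hT]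
    refine Finset.sum_congr rfl fun i _ => ?_
    rw [Finset.sum_comm]
    exact Finset.sum_congr rfl fun j _ => Finset.sum_congr rfl fun l _ => by rw [hH i l j]; ring
  -- the subspace and the bundled `4`-linear map
  let W : Submodule ℂ F :=
    { carrier := {a | Mem a}
      add_mem' := fun ha hb => hMadd _ _ ha hb
      zero_mem' := hM0
      smul_mem' := fun z _ ha => hMsmul z _ ha }
  let Λ : MultilinearMap ℂ (fun _ : Fin 4 => W) ℂ :=
    { toFun := fun mv => T (mv 0 : F) (mv 1) (mv 2) (mv 3)
      map_update_add' := by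
        intro inst mv i x y
        obtain rfl : inst = instDecidableEqFin 4 := Subsingleton.elim _ _
        fin_cases i <;> simp [hadd0, hadd1, hadd2, hadd3]
      map_update_smul' := by
        intro inst mv i t x
        obtain rfl : inst = instDecidableEqFin 4 := Subsingleton.elim _ _
        fin_cases i <;> simp [hsmul0, hsmul1, hsmul2, hsmul3] }
  have hΛ : ∀ mv : Fin 4 → W, Λ mv = T (mv 0 : F) (mv 1) (mv 2) (mv 3) := fun _ => rfl
  have hdiagW : ∀ v : W, Λ (fun _ => v) = 0 := fun v => hdiag v v.2
  have h24 := sum_perm_multilinear_eq_zero_of_forall_diag Λ hdiagW fun α => ⟨c α, hc α⟩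
  simp only [hΛ] at h24
  rw [sum_perm_fin_four (fun i j k l => T (c i) (c j) (c k) (c l))] at h24
  simp only [hswap (c 0) (c 1), hswap (c 0) (c 2), hswap (c 0) (c 3), hswap (c 1) (c 2), hswap (c 1) (c 3),
    hswap (c 2) (c 3)] at h24
  linear_combination (1 / 2 : ℂ) * h24

end Polar

section Quartet

variable {N m : ℕ}

/-- **The complexified Casimir expression of a homogeneous cubic is the quartic
`½ Σ H i j l · ℓⱼ(c) ℓₗ(c) Bᵢ(c, c)`** (Euler/Taylor for `∂ᵢPℂ`). [folklore] -/
theorem casimirC_eq_half_sum (v : Fin m → (Fin 3 → ℤ) → EuclideanSpace ℂ (Fin 3)) {P : MvPolynomial (Fin m) ℝ}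
    (hP : P.IsHomogeneous 3) (c : (Fin 3 → ℤ) → EuclideanSpace ℂ (Fin 3)) :
    ∑ i, MvPolynomial.eval (fun j => ∑ k ∈ (Torus.freqBall N).erase 0, ∑ a, c k a * v j (-k) a)
        (MvPolynomial.pderiv i (MvPolynomial.map (algebraMap ℝ ℂ) P)) *
      ∑ k ∈ Torus.freqBall N, ∑ a, (Torus.convectionCoeff (Torus.freqBall N) c (v i) k) a * c (-k) a =
      (1 / 2 : ℂ) * ∑ i, ∑ j, ∑ l,
        MvPolynomial.coeff 0 (MvPolynomial.pderiv i (MvPolynomial.pderiv j (MvPolynomial.pderiv l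
          (MvPolynomial.map (algebraMap ℝ ℂ) P)))) *
        (∑ k ∈ (Torus.freqBall N).erase 0, ∑ a, c k a * v j (-k) a) *
        (∑ k ∈ (Torus.freqBall N).erase 0, ∑ a, c k a * v l (-k) a) *
        ∑ k ∈ Torus.freqBall N, ∑ a, (Torus.convectionCoeff (Torus.freqBall N) c (v i) k) a * c (-k) a := by
  have h3 : (MvPolynomial.map (algebraMap ℝ ℂ) P).IsHomogeneous 3 := hP.map _
  -- abstract the inner sums
  set L : Fin m → ℂ := fun j => ∑ k ∈ (Torus.freqBall N).erase 0, ∑ a, c k a * v j (-k) a with hL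
  set Bv : Fin m → ℂ := fun i => ∑ k ∈ Torus.freqBall N, ∑ a,
    (Torus.convectionCoeff (Torus.freqBall N) c (v i) k) a * c (-k) a with hBv
  have hL' : ∀ j, ∑ k ∈ (Torus.freqBall N).erase 0, ∑ a, c k a * v j (-k) a = L j := fun j => rfl
  have hBv' : ∀ i, ∑ k ∈ Torus.freqBall N, ∑ a,
      (Torus.convectionCoeff (Torus.freqBall N) c (v i) k) a * c (-k) a = Bv i := fun i => rfl
  simp only [hL', hBv']
  simp_rw [eval_pderiv_eq_sum_of_isHomogeneous_three h3 L]
  simp only [Finset.mul_sum, Finset.sum_mul]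
  exact Finset.sum_congr rfl fun i _ => Finset.sum_congr rfl fun j _ => Finset.sum_congr rfl fun l _ => by ring

/-- Transversal single modes `x δ_w`, `w ∈ S*`, `x ⊥ w`, are complex families transversal on and
supported in `S*`. [folklore] -/
theorem single_mem {w : Fin 3 → ℤ} (hw : w ∈ (Torus.freqBall N).erase 0) {x : EuclideanSpace ℂ (Fin 3)}
    (hx : ∑ a, (w a : ℂ) * x a = 0) :
    Torus.IsTransversal ((Torus.freqBall N).erase 0) (Pi.single w x) ∧
      ∀ k ∉ (Torus.freqBall N).erase (0 : Fin 3 → ℤ), (Pi.single w x : (Fin 3 → ℤ) → EuclideanSpace ℂ (Fin 3)) k = 0 := by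
  refine ⟨fun k _ => ?_, fun k hk => Pi.single_eq_of_ne (fun h : k = w => hk (h ▸ hw)) _⟩
  by_cases h : k = w
  · subst h; rw [Pi.single_eq_same]; exact hx
  · rw [show (Pi.single w x : (Fin 3 → ℤ) → EuclideanSpace ℂ (Fin 3)) k = 0 from Pi.single_eq_of_ne h _]
    simp

/-- **Reindexing**: the contraction of the coefficient tensor with three vectors factors through the
three inner sums. [folklore] -/
theorem sum_tensor_contract (H : Fin m → Fin m → Fin m → ℂ) (A B C : Fin m → Fin 3 → ℂ) (t u z : Fin 3 → ℂ) :
    ∑ a : Fin 3, ∑ b : Fin 3, ∑ c : Fin 3, (∑ i, ∑ j, ∑ l, H i j l * A i a * B j b * C l c) * t a * u b * z c =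
      ∑ i, ∑ j, ∑ l, H i j l * (∑ a, A i a * t a) * (∑ b, B j b * u b) * (∑ c, C l c * z c) := by
  calc ∑ a : Fin 3, ∑ b : Fin 3, ∑ c : Fin 3, (∑ i, ∑ j, ∑ l, H i j l * A i a * B j b * C l c) * t a * u b * z c
      = ∑ a : Fin 3, ∑ b : Fin 3, ∑ c : Fin 3, ∑ i, ∑ j, ∑ l, H i j l * A i a * B j b * C l c * t a * u b * z c := by
        simp only [Finset.sum_mul]
    _ = ∑ x : Fin 3 × Fin 3 × Fin 3, ∑ y : Fin m × Fin m × Fin m,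
          H y.1 y.2.1 y.2.2 * A y.1 x.1 * B y.2.1 x.2.1 * C y.2.2 x.2.2 * t x.1 * u x.2.1 * z x.2.2 := by
        simp only [Fintype.sum_prod_type]
    _ = ∑ y : Fin m × Fin m × Fin m, ∑ x : Fin 3 × Fin 3 × Fin 3,
          H y.1 y.2.1 y.2.2 * A y.1 x.1 * B y.2.1 x.2.1 * C y.2.2 x.2.2 * t x.1 * u x.2.1 * z x.2.2 :=
        Finset.sum_comm
    _ = ∑ i, ∑ j, ∑ l, ∑ a : Fin 3, ∑ b : Fin 3, ∑ c : Fin 3, H i j l * A i a * B j b * C l c * t a * u b * z c := by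
        simp only [Fintype.sum_prod_type]
    _ = ∑ i, ∑ j, ∑ l, H i j l * (∑ a, A i a * t a) * (∑ b, B j b * u b) * (∑ c, C l c * z c) := by
        refine Finset.sum_congr rfl fun i _ => Finset.sum_congr rfl fun j _ => Finset.sum_congr rfl fun l _ => ?_
        symm
        rw [Finset.mul_sum (f := fun a => A i a * t a), Finset.sum_mul, Finset.sum_mul]
        refine Finset.sum_congr rfl fun a _ => ?_
        rw [Finset.mul_sum (f := fun b => B j b * u b), Finset.sum_mul]
        refine Finset.sum_congr rfl fun b _ => ?_
        rw [Finset.mul_sum (f := fun c => C l c * z c)]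
        exact Finset.sum_congr rfl fun c _ => by ring


/-- **A pair of polarised terms at single modes** (`ℓ`-slots `q₁, q₂`, bracket slots `p₁, p₂`,
symmetrised in the bracket slots): the pair transfer of `…CubicComplexifySingle`. [folklore] -/
theorem pair_eval (v : Fin m → (Fin 3 → ℤ) → EuclideanSpace ℂ (Fin 3)) (H : Fin m → Fin m → Fin m → ℂ)
    {p₁ p₂ q₁ q₂ : Fin 3 → ℤ} (hp₁ : p₁ ∈ (Torus.freqBall N).erase 0) (hp₂ : p₂ ∈ (Torus.freqBall N).erase 0)
    (hq₁ : q₁ ∈ (Torus.freqBall N).erase 0) (hq₂ : q₂ ∈ (Torus.freqBall N).erase 0)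
    {X₁ X₂ : EuclideanSpace ℂ (Fin 3)} (hX₁ : ∑ a, (p₁ a : ℂ) * X₁ a = 0) (hX₂ : ∑ a, (p₂ a : ℂ) * X₂ a = 0)
    (Y₁ Y₂ : EuclideanSpace ℂ (Fin 3)) :
    (∑ i, ∑ j, ∑ l, H i j l *
        (∑ k ∈ (Torus.freqBall N).erase 0, ∑ a, (Pi.single q₁ Y₁ : (Fin 3 → ℤ) → EuclideanSpace ℂ (Fin 3)) k a * v j (-k) a) *
        (∑ k ∈ (Torus.freqBall N).erase 0, ∑ a, (Pi.single q₂ Y₂ : (Fin 3 → ℤ) → EuclideanSpace ℂ (Fin 3)) k a * v l (-k) a) *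
        ∑ k ∈ Torus.freqBall N, ∑ a, (Torus.convectionCoeff (Torus.freqBall N) (Pi.single p₁ X₁) (v i) k) a *
          (Pi.single p₂ X₂ : (Fin 3 → ℤ) → EuclideanSpace ℂ (Fin 3)) (-k) a) +
      ∑ i, ∑ j, ∑ l, H i j l *
        (∑ k ∈ (Torus.freqBall N).erase 0, ∑ a, (Pi.single q₁ Y₁ : (Fin 3 → ℤ) → EuclideanSpace ℂ (Fin 3)) k a * v j (-k) a) *
        (∑ k ∈ (Torus.freqBall N).erase 0, ∑ a, (Pi.single q₂ Y₂ : (Fin 3 → ℤ) → EuclideanSpace ℂ (Fin 3)) k a * v l (-k) a) *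
        ∑ k ∈ Torus.freqBall N, ∑ a, (Torus.convectionCoeff (Torus.freqBall N) (Pi.single p₂ X₂) (v i) k) a *
          (Pi.single p₁ X₁ : (Fin 3 → ℤ) → EuclideanSpace ℂ (Fin 3)) (-k) a =
      (if p₁ + p₂ ∈ Torus.freqBall N then (1 : ℂ) else 0) * (-(2 * Real.pi * Complex.I)) *
        ∑ i, ∑ j, ∑ l, H i j l *
          (∑ a, v i (-(p₁ + p₂)) a * ((∑ d, X₁ d * (p₂ d : ℂ)) * X₂ a + (∑ d, X₂ d * (p₁ d : ℂ)) * X₁ a)) *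
          (∑ b, v j (-q₁) b * Y₁ b) * (∑ c, v l (-q₂) c * Y₂ c) := by
  simp_rw [← Finset.sum_add_distrib, ← mul_add]
  simp_rw [bracketForm_single_single_symm (Finset.mem_of_mem_erase hp₁) (Finset.mem_of_mem_erase hp₂) hX₁ hX₂,
    ell_single hq₁, ell_single hq₂]
  split_ifs with hS
  · rw [one_mul]
    conv_rhs => rw [Finset.mul_sum]
    refine Finset.sum_congr rfl fun i _ => ?_
    conv_rhs => rw [Finset.mul_sum]
    refine Finset.sum_congr rfl fun j _ => ?_
    conv_rhs => rw [Finset.mul_sum]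
    refine Finset.sum_congr rfl fun l _ => ?_
    have e1 : ∑ b, Y₁ b * v j (-q₁) b = ∑ b, v j (-q₁) b * Y₁ b := Finset.sum_congr rfl fun b _ => mul_comm _ _
    have e2 : ∑ c, Y₂ c * v l (-q₂) c = ∑ c, v l (-q₂) c * Y₂ c := Finset.sum_congr rfl fun c _ => mul_comm _ _
    rw [e1, e2]
    ring
  · simp

/-- **A target (core-shaped) term at single modes**: the contraction of the sector tensor with the
transfer vector and two amplitudes, factored through the inner sums. [folklore] -/
theorem target_pair (v : Fin m → (Fin 3 → ℤ) → EuclideanSpace ℂ (Fin 3)) (H : Fin m → Fin m → Fin m → ℂ)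
    (θ p₁ p₂ q₁ q₂ : Fin 3 → ℤ) (x₁ x₂ y₁ y₂ : Fin 3 → ℂ) :
    ∑ a : Fin 3, ∑ b : Fin 3, ∑ c : Fin 3,
      (if p₁ + p₂ ∈ (Torus.freqBall N).erase 0 ∧ q₁ ∈ (Torus.freqBall N).erase 0 ∧ q₂ ∈ (Torus.freqBall N).erase 0 ∧
          p₁ + p₂ + q₁ + q₂ = θ then
        (1 / 6 : ℂ) * ∑ i, ∑ j, ∑ l, H i j l * v i (-(p₁ + p₂)) a * v j (-q₁) b * v l (-q₂) c else 0) *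
      ((∑ d, x₁ d * (p₂ d : ℂ)) * x₂ a + (∑ d, x₂ d * (p₁ d : ℂ)) * x₁ a) * y₁ b * y₂ c =
      (if p₁ + p₂ ∈ (Torus.freqBall N).erase 0 ∧ q₁ ∈ (Torus.freqBall N).erase 0 ∧ q₂ ∈ (Torus.freqBall N).erase 0 ∧
          p₁ + p₂ + q₁ + q₂ = θ then (1 : ℂ) else 0) * (1 / 6 : ℂ) *
        ∑ i, ∑ j, ∑ l, H i j l *
          (∑ a, v i (-(p₁ + p₂)) a * ((∑ d, x₁ d * (p₂ d : ℂ)) * x₂ a + (∑ d, x₂ d * (p₁ d : ℂ)) * x₁ a)) *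
          (∑ b, v j (-q₁) b * y₁ b) * (∑ c, v l (-q₂) c * y₂ c) := by
  split_ifs with hc
  · rw [one_mul, ← sum_tensor_contract, Finset.mul_sum]
    refine Finset.sum_congr rfl fun a _ => ?_
    rw [Finset.mul_sum]
    refine Finset.sum_congr rfl fun b _ => ?_
    rw [Finset.mul_sum]
    refine Finset.sum_congr rfl fun c _ => ?_
    ring
  · simp

/-- A target term vanishes when the bracket-pair frequency is zero (`v j 0 = 0`). [folklore] -/
theorem inner_transfer_eq_zero (v : Fin m → (Fin 3 → ℤ) → EuclideanSpace ℂ (Fin 3)) (hv0 : ∀ j, v j 0 = 0)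
    (H : Fin m → Fin m → Fin m → ℂ) {p₁ p₂ : Fin 3 → ℤ} (h0 : p₁ + p₂ = 0) (q₁ q₂ : Fin 3 → ℤ) (τ y₁ y₂ : Fin 3 → ℂ) :
    ∑ i, ∑ j, ∑ l, H i j l * (∑ a, v i (-(p₁ + p₂)) a * τ a) * (∑ b, v j (-q₁) b * y₁ b) * (∑ c, v l (-q₂) c * y₂ c) = 0 := by
  refine Finset.sum_eq_zero fun i _ => Finset.sum_eq_zero fun j _ => Finset.sum_eq_zero fun l _ => ?_
  rw [h0, neg_zero, hv0 i]
  simp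


/-- Indicator bookkeeping between the punctured ball and the ball: if the weighted quantity vanishes at
the zero frequency, the two indicators agree. [folklore] -/
theorem indicator_erase_mul_eq {k : Fin 3 → ℤ} {r C : ℂ} (h0 : k = 0 → C = 0) :
    (if k ∈ (Torus.freqBall N).erase 0 then (1 : ℂ) else 0) * r * C =
      (if k ∈ Torus.freqBall N then (1 : ℂ) else 0) * r * C := by
  by_cases hk : k = 0
  · rw [h0 hk]; simp
  · simp only [Finset.mem_erase, ne_eq, hk, not_false_eq_true, true_and]

/-- **THE QUARTET IDENTITY for the sector tensors.** Let `vⱼ` be test families with `vⱼ 0 = 0`, `P` a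
real homogeneous cubic, and suppose the complexified Casimir expression vanishes on every complex
family transversal on and supported in `S* = (freqBall N).erase 0`. Then for every sector `θ`, every
quadruple of frequencies `wᵢ ∈ S*` and amplitudes `xᵢ ⊥ wᵢ`, the sector tensor
`Γ_θ k p q a b c = [k, p, q ∈ S*, k+p+q = θ] · (1/6) Σ H i j l vᵢ(-k)_a vⱼ(-p)_b vₗ(-q)_c` satisfies the
cores' quartet identity (sum over the pair splittings of `{0,1,2,3}` of the pair transfer of one pair
contracted against the other). [folklore] -/
theorem quartet_identity (N : ℕ) {m : ℕ} (v : Fin m → (Fin 3 → ℤ) → EuclideanSpace ℂ (Fin 3))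
    (hv0 : ∀ j, v j 0 = 0) {P : MvPolynomial (Fin m) ℝ} (hP : P.IsHomogeneous 3)
    (hG : ∀ c : (Fin 3 → ℤ) → EuclideanSpace ℂ (Fin 3), Torus.IsTransversal ((Torus.freqBall N).erase 0) c →
      (∀ k ∉ (Torus.freqBall N).erase (0 : Fin 3 → ℤ), c k = 0) →
      ∑ i, MvPolynomial.eval (fun j => ∑ k ∈ (Torus.freqBall N).erase 0, ∑ a, c k a * v j (-k) a)
          (MvPolynomial.pderiv i (MvPolynomial.map (algebraMap ℝ ℂ) P)) *
        ∑ k ∈ Torus.freqBall N, ∑ a, (Torus.convectionCoeff (Torus.freqBall N) c (v i) k) a * c (-k) a = 0)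
    (θ : Fin 3 → ℤ) (w : Fin 4 → Fin 3 → ℤ) (x : Fin 4 → Fin 3 → ℂ)
    (hw : ∀ α, w α ∈ (Torus.freqBall N).erase 0) (hx : ∀ α, ∑ a, (w α a : ℂ) * x α a = 0) :
    ∑ p ∈ (Finset.univ : Finset (Fin 4 × Fin 4)).filter (fun p => p.1 < p.2),
      ∑ q ∈ (Finset.univ : Finset (Fin 4 × Fin 4)).filter
        (fun q => q.1 < q.2 ∧ q.1 ≠ p.1 ∧ q.1 ≠ p.2 ∧ q.2 ≠ p.1 ∧ q.2 ≠ p.2),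
        ∑ a, ∑ b, ∑ c,
          (if w p.1 + w p.2 ∈ (Torus.freqBall N).erase 0 ∧ w q.1 ∈ (Torus.freqBall N).erase 0 ∧
                w q.2 ∈ (Torus.freqBall N).erase 0 ∧ w p.1 + w p.2 + w q.1 + w q.2 = θ then
              (1 / 6 : ℂ) * ∑ i, ∑ j, ∑ l,
                MvPolynomial.coeff 0 (MvPolynomial.pderiv i (MvPolynomial.pderiv j (MvPolynomial.pderiv l
                  (MvPolynomial.map (algebraMap ℝ ℂ) P)))) *
                v i (-(w p.1 + w p.2)) a * v j (-w q.1) b * v l (-w q.2) c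
            else 0) *
          ((∑ d, x p.1 d * (w p.2 d : ℂ)) * x p.2 a + (∑ d, x p.2 d * (w p.1 d : ℂ)) * x p.1 a) *
            x q.1 b * x q.2 c = 0 := by
  classical
  -- amplitudes as Euclidean vectors
  set X : Fin 4 → EuclideanSpace ℂ (Fin 3) := fun α => WithLp.toLp 2 (x α) with hXdef
  have hXx : ∀ α a, X α a = x α a := fun α a => rfl
  have hX : ∀ α, ∑ a, (w α a : ℂ) * X α a = 0 := fun α => by simp only [hXx]; exact hx α
  have hS : ∀ α, w α ∈ Torus.freqBall N := fun α => Finset.mem_of_mem_erase (hw α)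
  -- the coefficient tensor
  set H : Fin m → Fin m → Fin m → ℂ := fun i j l => MvPolynomial.coeff 0 (MvPolynomial.pderiv i
    (MvPolynomial.pderiv j (MvPolynomial.pderiv l (MvPolynomial.map (algebraMap ℝ ℂ) P)))) with hHdef
  have hH' : ∀ i j l, MvPolynomial.coeff 0 (MvPolynomial.pderiv i (MvPolynomial.pderiv j (MvPolynomial.pderiv l
      (MvPolynomial.map (algebraMap ℝ ℂ) P)))) = H i j l := fun _ _ _ => rfl
  -- the twelve-term polarisation at the single modes
  have h12 := quartet_of_diag (F := (Fin 3 → ℤ) → EuclideanSpace ℂ (Fin 3))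
    (fun j c => ∑ k ∈ (Torus.freqBall N).erase 0, ∑ a, c k a * v j (-k) a)
    (fun i c c' => ∑ k ∈ Torus.freqBall N, ∑ a, (Torus.convectionCoeff (Torus.freqBall N) c (v i) k) a * c' (-k) a)
    H (fun c => Torus.IsTransversal ((Torus.freqBall N).erase 0) c ∧
      ∀ k ∉ (Torus.freqBall N).erase (0 : Fin 3 → ℤ), c k = 0)
    (fun j a b => ell_add_left _ a b (v j)) (fun j z a => ell_smul_left _ z a (v j))
    (fun i a b y => bracketForm_add_left _ a b (v i) y) (fun i z a y => bracketForm_smul_left _ z a (v i) y)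
    (fun i y a b => bracketForm_add_right _ y (v i) a b) (fun i z y a => bracketForm_smul_right _ z y (v i) a)
    (fun i j l => coeff_pderiv_pderiv_pderiv_swap_right _ i j l)
    (fun a b ha hb => ⟨fun k hk => by
        simp only [Pi.add_apply, WithLp.ofLp_add, mul_add, Finset.sum_add_distrib, ha.1 k hk, hb.1 k hk, add_zero],
      fun k hk => by rw [Pi.add_apply, ha.2 k hk, hb.2 k hk, add_zero]⟩)
    ⟨fun k _ => by simp, fun k _ => rfl⟩
    (fun z a ha => ⟨fun k hk => by
        simp only [Pi.smul_apply, PiLp.smul_apply, smul_eq_mul, ← Finset.mul_sum, mul_left_comm _ z, ha.1 k hk,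
          mul_zero],
      fun k hk => by rw [Pi.smul_apply, ha.2 k hk, smul_zero]⟩)
    (fun c hc => by
      have h := hG c hc.1 hc.2
      rw [casimirC_eq_half_sum v hP c] at h
      simp only [hH'] at h
      have h2 : (2 : ℂ) * ((1 / 2 : ℂ) * ∑ i, ∑ j, ∑ l, H i j l *
          (∑ k ∈ (Torus.freqBall N).erase 0, ∑ a, c k a * v j (-k) a) *
          (∑ k ∈ (Torus.freqBall N).erase 0, ∑ a, c k a * v l (-k) a) *
          ∑ k ∈ Torus.freqBall N, ∑ a, (Torus.convectionCoeff (Torus.freqBall N) c (v i) k) a * c (-k) a) = 0 := by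
        rw [h, mul_zero]
      linear_combination h2)
    (fun α => Pi.single (w α) (X α)) (fun α => single_mem (hw α) (hX α))
  dsimp only at h12
  rw [pair_eval v H (hw 0) (hw 1) (hw 2) (hw 3) (hX 0) (hX 1) (X 2) (X 3),
    pair_eval v H (hw 0) (hw 2) (hw 1) (hw 3) (hX 0) (hX 2) (X 1) (X 3),
    pair_eval v H (hw 0) (hw 3) (hw 1) (hw 2) (hX 0) (hX 3) (X 1) (X 2),
    pair_eval v H (hw 1) (hw 2) (hw 0) (hw 3) (hX 1) (hX 2) (X 0) (X 3),
    pair_eval v H (hw 1) (hw 3) (hw 0) (hw 2) (hX 1) (hX 3) (X 0) (X 2),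
    pair_eval v H (hw 2) (hw 3) (hw 0) (hw 1) (hX 2) (hX 3) (X 0) (X 1)] at h12
  simp only [hXx] at h12
  -- the target side
  rw [sum_pairs_fin_four]
  dsimp only
  simp only [hH']
  rw [target_pair v H θ (w 0) (w 1) (w 2) (w 3) (x 0) (x 1) (x 2) (x 3),
    target_pair v H θ (w 0) (w 2) (w 1) (w 3) (x 0) (x 2) (x 1) (x 3),
    target_pair v H θ (w 0) (w 3) (w 1) (w 2) (x 0) (x 3) (x 1) (x 2),
    target_pair v H θ (w 1) (w 2) (w 0) (w 3) (x 1) (x 2) (x 0) (x 3),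
    target_pair v H θ (w 1) (w 3) (w 0) (w 2) (x 1) (x 3) (x 0) (x 2),
    target_pair v H θ (w 2) (w 3) (w 0) (w 1) (x 2) (x 3) (x 0) (x 1)]
  -- total momentum of every splitting
  have t2 : w 0 + w 2 + w 1 + w 3 = w 0 + w 1 + w 2 + w 3 := by abel
  have t3 : w 0 + w 3 + w 1 + w 2 = w 0 + w 1 + w 2 + w 3 := by abel
  have t4 : w 1 + w 2 + w 0 + w 3 = w 0 + w 1 + w 2 + w 3 := by abel
  have t5 : w 1 + w 3 + w 0 + w 2 = w 0 + w 1 + w 2 + w 3 := by abel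
  have t6 : w 2 + w 3 + w 0 + w 1 = w 0 + w 1 + w 2 + w 3 := by abel
  rw [t2, t3, t4, t5, t6]
  by_cases hθ : w 0 + w 1 + w 2 + w 3 = θ
  · simp only [hw, hθ, and_true]
    rw [indicator_erase_mul_eq (inner_transfer_eq_zero v hv0 H · (w 2) (w 3) _ _ _),
      indicator_erase_mul_eq (inner_transfer_eq_zero v hv0 H · (w 1) (w 3) _ _ _),
      indicator_erase_mul_eq (inner_transfer_eq_zero v hv0 H · (w 1) (w 2) _ _ _),
      indicator_erase_mul_eq (inner_transfer_eq_zero v hv0 H · (w 0) (w 3) _ _ _),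
      indicator_erase_mul_eq (inner_transfer_eq_zero v hv0 H · (w 0) (w 2) _ _ _),
      indicator_erase_mul_eq (inner_transfer_eq_zero v hv0 H · (w 0) (w 1) _ _ _)]
    have hK : (-(2 * Real.pi * Complex.I) : ℂ) ≠ 0 := by
      simp [Real.pi_ne_zero, Complex.I_ne_zero]
    refine mul_left_cancel₀ hK ?_
    rw [mul_zero]
    linear_combination (1 / 6 : ℂ) * h12
  · simp [hθ]

end Quartet


end

/-! ## Registered sub-goal (summary) -/

/-- **Registered sub-goal `cubicAssembly_indicator_erase` (compact anchor of this file, whose main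
result is `quartet_identity`)**: the punctured-ball and ball indicators agree against a quantity
vanishing at the zero frequency. [folklore] -/
theorem cubicAssembly_indicator_erase : ∀ (N : ℕ) (k : Fin 3 → ℤ) (r C : ℂ), (k = 0 → C = 0) → (if k ∈ (Torus.freqBall N).erase 0 then (1 : ℂ) else 0) * r * C = (if k ∈ Torus.freqBall N then (1 : ℂ) else 0) * r * C :=
  fun _ _ _ _ h0 => indicator_erase_mul_eq h0

end Summit.AnomalousDissipation.AnomalousDissipation.Theorems.MomentParityQuarticGate
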